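import Summits.BirchSwinnertonDyer.Rank1Residual.GaloisImage.KatoKuriharaValueRowsOfZetaBody
import HarnessLib

/-!
# The per-level VALUE ROWS of the Kato–Kurihara port from `ZetaBody` at ANY prime `p` of the level — the
# `p`-Euler factor of Kato's depleted `L`-value absorbed into the twist (cell `bsd-addord`, seat w2-c3 gen 6;
# route W2 `KimAtThreeKolyvagin`, crux 19076 `DeepUpperAtThree`, child 19562 — NON-ADDITIVE rows at `3`)

HONEST FRAMING: END-TYPE TOOL theorems with displayed hypotheses (no definition, no named fact, no instance, no
`sorry`); Kato's fact `ZetaBody` enters as the displayed HYPOTHESIS `hbody` (never obtained); nothing about any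
curve is asserted; nothing booked; BSD is not proved by any of this.

## What, and why

n1011-p02's `ValueRow.valueRow_of_zetaBody` (T-PK6-VDIS) produces the per-level VALUE ROWS
`∃ s u ψ, hval(s) ∧ s̄ = u · p^t · δ̃_n` of ★ PK-6₂ from `ZetaBody` under the guard `hpN : p² ∣ N` — additive
reduction at `p`, used at exactly one point: the twist `Vq = (1 + δ₋₁)·δ_{u⁻¹}uκ·∏_{q ∣ pA} E_q(σ_q)·C⁻`
(`E_q(σ) = 1 − (a_q/q)σ_q⁻¹ + (𝟙_{q∤N}/q)σ_q⁻²`, Kato's depletion at `S = prime(pA)`) must have an INTEGRAL lift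
`V ∈ ℤ_p[(ℤ/n)ˣ]` with UNIT augmentation, and at `q = p` the scalars `a_p/p`, `𝟙/p` are integral only when
`a_p = 0 ∧ p ∣ N`.  At a good or multiplicative `p` the factor `E_p(σ_p) = p⁻¹(p − a_pσ_p⁻¹ + 𝟙σ_p⁻²)` is NOT
integral — but the PRODUCT `uκ · E_p(σ_p)` is, as soon as `p ∣ uκ` (Kato's constant read in a coordinate where
the functional `Λ` is `p · exp*_ω`, Kim AJM 148 Lemma 3.4: `exp*_ω(H¹(ℚ_p,T)) = (#Ẽ_ns(𝔽_p)·c_p/p^{1+t})ℤ_p`),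
and its augmentation `2·uκ·∏_q E_q(1)·R⁻` is a unit as soon as `v_p(uκ·∏_q E_q(1)) = 0` — at a good
NON-ANOMALOUS or multiplicative `p`: `v_p(uκ) = 1`, `E_p(1) = #Ẽ_ns(𝔽_p)/p` with `p ∤ #Ẽ_ns(𝔽_p)`.  So:
* §1 `exists_padicLift_twist_scaled` — FILE 2's `exists_padicLift_twist` with the `p`-factor regrouped:
  integrality of `uκ`, `uκ·a_p/p`, `uκ·𝟙_{p∤N}/p` and of `a_q/q`, `𝟙/q` for `q ∣ pA`, `q ≠ p`;
* §2 `isUnit_sum_coeff_twist_of_combined_certificate` — FILE 2's unit augmentation from the COMBINED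
  certificate `v_p(uκ · ∏_{q∣pA} E_q(1)) = 0` (+ `v_p(R⁻) = 0`, `p ≠ 2`);
* §3 ★★ `valueRow_of_zetaBody_general` — `valueRow_of_zetaBody` WITHOUT `hpN`, with the binders
  (`uκ`, `huκ1`, `hκa`, `hκ1`, `hκE`) in place of (`hNorm`, `hpN`, `hE`); everything else token for token.
  The additive case is recovered with `v_p(uκ) = 0` (then `hκa`/`hκ1` hold by `a_p = 0`, `p ∣ N`).
NOT covered (honest limit): a good ANOMALOUS `p` (`p ∣ #Ẽ(𝔽_p)`), where the augmentation is `p^{α}·unit` —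
it needs the non-unit twin of T-PK6-VROW FILE 1 (value exponent `t + α`); recorded in the seat memo.
References: [Kato2004Asterisque] Thm. 6.6 (1) (p. 163), §6.2 (p. 161), Thm. 9.7 (p. 189), Ex. 13.3;
[Kim2022StructureSelmer] Lemma 3.4, §3.2.3, §3.4.1–§3.5 and the proof of Thm. 3.13 (arXiv v3 pp. 16, 26–28:
"`E_p(σ_p)·δ̃_n = E_p·δ̃_n`"); [KimNakamura2020] Prop. 3.5; [MazurTateTeitelbaum1986Invent] §I.8;
n1011 design `cells/n1011/ROUTE-1.md` §58; this seat's NOTES `## Design (gen 6)`.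
-/

noncomputable section

open scoped BigOperators NumberField TensorProduct
open Finset IsDedekindDomain NumberField Field WeierstrassCurve Rat.HeightOneSpectrum MonoidAlgebra
open Literature.NumberTheory.GaloisRepresentations Literature.NumberTheory.GaloisCohomology
open Literature.NumberTheory.EllipticCurves Literature.NumberTheory.EllipticCurves.ModularForms
open Literature.NumberTheory.EllipticCurves.Kato2004
open Literature.NumberTheory.EllipticCurves.Kato2004.EulerSystemValues
open Summit.BirchSwinnertonDyer.Rank1Residual.GaloisImage
open Summit.BirchSwinnertonDyer.Rank1Residual.GaloisImage.ValueRow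

-- the cell's Theorems namespace repeats the summit name by design (D-0017)
set_option linter.dupNamespace false

namespace Summit.BirchSwinnertonDyer.BirchSwinnertonDyer.Theorems.KimAtThreeDeepUpperValueRowsGeneral

/-! ### §1 The integral lift of the twist with the `p`-factor regrouped -/

section Twist

variable (p : ℕ) [Fact p.Prime] {n : ℕ}

/-- **The twist of PK-4b-C4b-2 (v) has an INTEGRAL LIFT `V ∈ ℤ_p[(ℤ/n)ˣ]`** as soon as `uκ`, `uκ·a_p/p`,
`uκ·𝟙_{p∤N}/p`, the scalars `a_q/q`, `𝟙_{q∤N}/q` for `q ∣ M`, `q ≠ p`, and the four cusp symbols are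
`p`-integral (`p ∣ M`): n1011-p02's `exists_padicLift_twist` with the factor at `q = p` multiplied into the
monomial `δ_{u⁻¹}uκ` before lifting.  The image of `ℤ_p[G] → ℚ_p[G]` is a subring. [folklore] -/
theorem exists_padicLift_twist_scaled {N₀ : ℕ} (f : CuspForm (CongruenceSubgroup.Gamma0 N₀) 2)
    (u : (ZMod n)ˣ) (uκ : ℚ) (M N : ℕ) (uq : ℕ → (ZMod n)ˣ) (aM : ℕ → ℤ)
    (Eq : MonoidAlgebra ℚ (ZMod n)ˣ)
    (hEq : Eq = ∏ q ∈ M.primeFactors, (1 - MonoidAlgebra.single (uq q)⁻¹ ((aM q : ℚ) / q) +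
      MonoidAlgebra.single ((uq q)⁻¹ ^ 2) (if q ∣ N then 0 else (1 / q : ℚ))))
    (c d a d' : ℤ) (A : ℕ) (uc ud : (ZMod n)ˣ)
    (Cq : MonoidAlgebra ℚ (ZMod n)ˣ)
    (hCq : Cq = algebraMap ℚ _ ((c : ℚ) ^ 2 * (d : ℚ) ^ 2 * ratMinusSymbol f ((a : ℚ) / A)) -
      MonoidAlgebra.single uc ((c : ℚ) * (d : ℚ) ^ 2 * ratMinusSymbol f ((a * c : ℚ) / A)) -
      MonoidAlgebra.single ud ((c : ℚ) ^ 2 * (d : ℚ) * ratMinusSymbol f ((a * d' : ℚ) / A)) +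
      MonoidAlgebra.single (uc * ud) ((c : ℚ) * (d : ℚ) * ratMinusSymbol f ((a * c * d' : ℚ) / A)))
    (Vq : MonoidAlgebra ℚ (ZMod n)ˣ)
    (hVq : Vq = (1 + MonoidAlgebra.single (-1 : (ZMod n)ˣ) (1 : ℚ)) * MonoidAlgebra.single u⁻¹ uκ * Eq * Cq)
    (hpM : p ∈ M.primeFactors)
    (huκ : ‖(uκ : ℚ_[p])‖ ≤ 1)
    (hκa : ‖((uκ * ((aM p : ℚ) / p) : ℚ) : ℚ_[p])‖ ≤ 1)
    (hκ1 : ‖((uκ * (if p ∣ N then 0 else (1 / p : ℚ)) : ℚ) : ℚ_[p])‖ ≤ 1)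
    (haq : ∀ q ∈ M.primeFactors.erase p, ‖((((aM q : ℚ) / q : ℚ)) : ℚ_[p])‖ ≤ 1)
    (hNq : ∀ q ∈ M.primeFactors.erase p, ‖(((if q ∣ N then 0 else (1 / q : ℚ)) : ℚ) : ℚ_[p])‖ ≤ 1)
    (hs₁ : ‖((ratMinusSymbol f ((a : ℚ) / A) : ℚ) : ℚ_[p])‖ ≤ 1)
    (hs₂ : ‖((ratMinusSymbol f ((a * c : ℚ) / A) : ℚ) : ℚ_[p])‖ ≤ 1)
    (hs₃ : ‖((ratMinusSymbol f ((a * d' : ℚ) / A) : ℚ) : ℚ_[p])‖ ≤ 1)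
    (hs₄ : ‖((ratMinusSymbol f ((a * c * d' : ℚ) / A) : ℚ) : ℚ_[p])‖ ≤ 1) :
    ∃ V : MonoidAlgebra ℤ_[p] (ZMod n)ˣ,
      MonoidAlgebra.mapRingHom (ZMod n)ˣ (PadicInt.Coe.ringHom (p := p)) V =
        MonoidAlgebra.mapRingHom (ZMod n)ˣ (algebraMap ℚ ℚ_[p]) Vq := by
  classical
  -- the rational group-ring elements whose base change to `ℚ_p` comes from `ℤ_p[G]` form a subring
  let S : Subring (MonoidAlgebra ℚ (ZMod n)ˣ) :=
    (MonoidAlgebra.mapRingHom (ZMod n)ˣ (PadicInt.Coe.ringHom (p := p))).range.comap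
      (MonoidAlgebra.mapRingHom (ZMod n)ˣ (algebraMap ℚ ℚ_[p]))
  have hsingle : ∀ (g : (ZMod n)ˣ) {q : ℚ}, ‖(q : ℚ_[p])‖ ≤ 1 → MonoidAlgebra.single g q ∈ S :=
    fun g q h => Subring.mem_comap.mpr (by
      rw [MonoidAlgebra.mapRingHom_single]
      exact single_algebraMap_mem_range_mapRingHom p g h)
  have halg : ∀ {q : ℚ}, ‖(q : ℚ_[p])‖ ≤ 1 → algebraMap ℚ (MonoidAlgebra ℚ (ZMod n)ˣ) q ∈ S :=
    fun h => Subring.mem_comap.mpr (algebraMap_mem_range_mapRingHom p h)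
  suffices h : Vq ∈ S by
    obtain ⟨V, hV⟩ := Subring.mem_comap.mp h
    exact ⟨V, hV⟩
  have hc : ‖((c : ℚ) : ℚ_[p])‖ ≤ 1 := norm_ratCast_intCast_le_one p c
  have hd : ‖((d : ℚ) : ℚ_[p])‖ ≤ 1 := norm_ratCast_intCast_le_one p d
  have hc2 : ‖(((c : ℚ) ^ 2 : ℚ) : ℚ_[p])‖ ≤ 1 := by rw [sq]; exact norm_ratCast_mul_le_one p hc hc
  have hd2 : ‖(((d : ℚ) ^ 2 : ℚ) : ℚ_[p])‖ ≤ 1 := by rw [sq]; exact norm_ratCast_mul_le_one p hd hd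
  -- the factor at `q = p`, multiplied into `δ_{u⁻¹} uκ`, is integral
  set F : ℕ → MonoidAlgebra ℚ (ZMod n)ˣ := fun q => 1 - MonoidAlgebra.single (uq q)⁻¹ ((aM q : ℚ) / q) +
      MonoidAlgebra.single ((uq q)⁻¹ ^ 2) (if q ∣ N then 0 else (1 / q : ℚ)) with hF
  have h1 : MonoidAlgebra.single u⁻¹ uκ * F p ∈ S := by
    rw [hF]
    dsimp only
    rw [mul_add, mul_sub, mul_one, MonoidAlgebra.single_mul_single, MonoidAlgebra.single_mul_single]
    exact add_mem (sub_mem (hsingle _ huκ) (hsingle _ hκa)) (hsingle _ hκ1)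
  have h2 : ∏ q ∈ M.primeFactors.erase p, F q ∈ S :=
    prod_mem fun q hq => add_mem (sub_mem (one_mem S) (hsingle _ (haq q hq))) (hsingle _ (hNq q hq))
  have hC : Cq ∈ S := by
    subst hCq
    refine add_mem (sub_mem (sub_mem (halg ?_) (hsingle _ ?_)) (hsingle _ ?_)) (hsingle _ ?_)
    · exact norm_ratCast_mul_le_one p (norm_ratCast_mul_le_one p hc2 hd2) hs₁
    · exact norm_ratCast_mul_le_one p (norm_ratCast_mul_le_one p hc hd2) hs₂
    · exact norm_ratCast_mul_le_one p (norm_ratCast_mul_le_one p hc2 hd) hs₃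
    · exact norm_ratCast_mul_le_one p (norm_ratCast_mul_le_one p hc hd) hs₄
  have h01 : (1 + MonoidAlgebra.single (-1 : (ZMod n)ˣ) (1 : ℚ)) ∈ S :=
    add_mem (one_mem S) (hsingle _ (by rw [Rat.cast_one, norm_one]))
  have hEq' : Eq = F p * ∏ q ∈ M.primeFactors.erase p, F q := by
    rw [hEq, ← Finset.mul_prod_erase _ _ hpM]
  rw [hVq, hEq', ← mul_assoc (_ * MonoidAlgebra.single u⁻¹ uκ) (F p), mul_assoc _ (MonoidAlgebra.single u⁻¹ uκ) (F p)]
  exact mul_mem (mul_mem (mul_mem h01 h1) h2) hC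

/-! ### §2 Unit augmentation from the combined certificate -/

variable [NeZero n]

/-- **The integral twist has unit augmentation from the COMBINED certificate** `v_p(uκ·∏_{q∣M} E_q(1)) = 0`
(+ `v_p(R⁻) = 0`, `p ≠ 2`): `aug Vq = 2·uκ·∏_q E_q(1)·R⁻` (FILE 2 `sum_coeff_twist_eq`).  At an additive `p`
this is END-m1's pair of certificates `v_p(uκ) = 0 = v_p(∏)`; at a good non-anomalous / multiplicative `p`
it reads `v_p(uκ) = 1`, `v_p(∏) = −1`. [cite: Kim2022StructureSelmer, Lemma 3.4 and the proof of Thm. 3.13 (arXiv v3 pp. 16, 26–28)] -/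
theorem isUnit_sum_coeff_twist_of_combined_certificate (hp2 : p ≠ 2) {N₀ : ℕ}
    (f : CuspForm (CongruenceSubgroup.Gamma0 N₀) 2)
    (u : (ZMod n)ˣ) (uκ : ℚ) (M N : ℕ) (uq : ℕ → (ZMod n)ˣ) (aM : ℕ → ℤ)
    (Eq : MonoidAlgebra ℚ (ZMod n)ˣ)
    (hEq : Eq = ∏ q ∈ M.primeFactors, (1 - MonoidAlgebra.single (uq q)⁻¹ ((aM q : ℚ) / q) +
      MonoidAlgebra.single ((uq q)⁻¹ ^ 2) (if q ∣ N then 0 else (1 / q : ℚ))))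
    (c d a d' : ℤ) (A : ℕ) (uc ud : (ZMod n)ˣ)
    (Cq : MonoidAlgebra ℚ (ZMod n)ˣ)
    (hCq : Cq = algebraMap ℚ _ ((c : ℚ) ^ 2 * (d : ℚ) ^ 2 * ratMinusSymbol f ((a : ℚ) / A)) -
      MonoidAlgebra.single uc ((c : ℚ) * (d : ℚ) ^ 2 * ratMinusSymbol f ((a * c : ℚ) / A)) -
      MonoidAlgebra.single ud ((c : ℚ) ^ 2 * (d : ℚ) * ratMinusSymbol f ((a * d' : ℚ) / A)) +
      MonoidAlgebra.single (uc * ud) ((c : ℚ) * (d : ℚ) * ratMinusSymbol f ((a * c * d' : ℚ) / A)))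
    (Vq : MonoidAlgebra ℚ (ZMod n)ˣ)
    (hVq : Vq = (1 + MonoidAlgebra.single (-1 : (ZMod n)ˣ) (1 : ℚ)) * MonoidAlgebra.single u⁻¹ uκ * Eq * Cq)
    (V : MonoidAlgebra ℤ_[p] (ZMod n)ˣ)
    (hV : MonoidAlgebra.mapRingHom (ZMod n)ˣ (PadicInt.Coe.ringHom (p := p)) V =
      MonoidAlgebra.mapRingHom (ZMod n)ˣ (algebraMap ℚ ℚ_[p]) Vq)
    (huκ0 : uκ ≠ 0)
    (hE0 : ∏ q ∈ M.primeFactors, (1 - (aM q : ℚ) / q + (if q ∣ N then 0 else (1 / q : ℚ))) ≠ 0)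
    (hκE : padicValRat p
      (uκ * ∏ q ∈ M.primeFactors, (1 - (aM q : ℚ) / q + (if q ∣ N then 0 else (1 / q : ℚ)))) = 0)
    (hR0 : (c : ℚ) ^ 2 * (d : ℚ) ^ 2 * ratMinusSymbol f ((a : ℚ) / A) -
        (c : ℚ) * (d : ℚ) ^ 2 * ratMinusSymbol f ((a * c : ℚ) / A) -
        (c : ℚ) ^ 2 * (d : ℚ) * ratMinusSymbol f ((a * d' : ℚ) / A) +
        (c : ℚ) * (d : ℚ) * ratMinusSymbol f ((a * c * d' : ℚ) / A) ≠ 0)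
    (hR : padicValRat p ((c : ℚ) ^ 2 * (d : ℚ) ^ 2 * ratMinusSymbol f ((a : ℚ) / A) -
        (c : ℚ) * (d : ℚ) ^ 2 * ratMinusSymbol f ((a * c : ℚ) / A) -
        (c : ℚ) ^ 2 * (d : ℚ) * ratMinusSymbol f ((a * d' : ℚ) / A) +
        (c : ℚ) * (d : ℚ) * ratMinusSymbol f ((a * c * d' : ℚ) / A)) = 0) :
    IsUnit (∑ g : (ZMod n)ˣ, V.coeff g) := by
  haveI : Fact p.Prime := inferInstance
  have haug := sum_coeff_twist_eq f u uκ M N uq aM Eq hEq c d a d' A uc ud Cq hCq Vq hVq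
  refine isUnit_sum_coeff_of_padicValRat_eq_zero p V Vq hV ?_ ?_
  · rw [haug]
    exact mul_ne_zero (mul_ne_zero (mul_ne_zero two_ne_zero huκ0) hE0) hR0
  · rw [haug, mul_assoc (2 : ℚ) uκ, padicValRat.mul (mul_ne_zero two_ne_zero (mul_ne_zero huκ0 hE0)) hR0,
      padicValRat.mul two_ne_zero (mul_ne_zero huκ0 hE0), hκE, hR]
    have h2 : padicValRat p 2 = 0 := by
      rw [show (2 : ℚ) = ((2 : ℕ) : ℚ) by norm_num, padicValRat.of_nat]
      norm_cast
      exact padicValNat.eq_zero_of_not_dvd fun h =>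
        hp2 ((Nat.prime_dvd_prime_iff_eq Fact.out Nat.prime_two).1 h)
    rw [h2]
    ring

end Twist

/-! ### §3 ★★ The value row at `(j, σ, r)` from `ZetaBody`, any prime `p` of the level -/

section Main

variable {W : WeierstrassCurve ℚ} [W.IsElliptic] [W.IsGloballyMinimal] {p : ℕ} [Fact p.Prime]
  [ContinuousSMul ℤ_[p] (W.tateModule p)] [Module.Free ℤ_[p] (W.tateModule p)]
  [Module.Finite ℤ_[p] (W.tateModule p)] {N : ℕ} [NeZero N] {f : CuspForm (CongruenceSubgroup.Gamma0 N) 2}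
  {ι : (m : ℕ) → (CyclotomicField m ℚ →+* ℂ)} {κ : ℝ}
  {Λ : ∀ (k : ℕ) (r : Finset (HeightOneSpectrum (𝓞 ℚ))),
    H1 (tateRep W p) (cycSubgroup p k r) →ₗ[ℤ_[p]] ℚ_[p] ⊗[ℚ] CyclotomicField (cycLevel p k r) ℚ}
  {c d a : ℤ} {A : ℕ} [NeZero A]
  {z : ∀ (k : ℕ) (r : (cyclotomicLevelsRat p (badPlaces c d A N)).Ideals),
    H1 (tateRep W p) ((cyclotomicLevelsRat p (badPlaces c d A N)).level k r.1)}
  {x : ∀ (k : ℕ) (r : (cyclotomicLevelsRat p (badPlaces c d A N)).Ideals),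
    CyclotomicField (cycLevel p k r.1) ℚ}

set_option backward.isDefEq.respectTransparency false in
/-- **★★ THE VALUE ROW at `(j, σ, r)` FROM `ZetaBody`, ANY PRIME `p` OF THE LEVEL** — n1011-p02's
`valueRow_of_zetaBody` with the guard `hpN : p² ∣ N` REMOVED: Kato's constant is displayed as a rational
`uκ` with `uκ`, `uκ·a_p/p`, `uκ·𝟙_{p∤N}/p` `p`-integral (`huκ1`, `hκa`, `hκ1`) and the COMBINED unit
certificate `v_p(uκ·∏_{q∣pA} E_q(1)) = 0` (`hκE`); every other binder (`hbody`, `hf`, `hp2`, `hirr`, `d′`,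
`hcd`, `hdd′`, `hAN`, `aM`/`haM`, `hE0`, `hR0`/`hR`, `η`, `j`, `t`, `σ`, `r`, …) and the conclusion VERBATIM.
Proof = the original's, with §1/§2 of this file at the lift / unit steps.
[cite: Kim2022StructureSelmer, §1.4.1, Lemma 3.4, §3.4.1–§3.5 and the proof of Thm. 3.13 (arXiv v3 pp. 7, 16, 26–28)]
[cite: Kato2004Asterisque, Thm. 6.6 (1) (p. 163), §6.2 (p. 161) and Thm. 9.7 (p. 189)]
[cite: MazurTateTeitelbaum1986Invent, §I.8] -/
theorem valueRow_of_zetaBody_general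
    (hbody : ZetaBody W p f ι κ Λ c d a A z x) (hf : IsNewformOf W f) (hp2 : p ≠ 2)
    (hirr : W.HasIrreducibleModPGaloisRep p)
    -- Kato's constant in the coordinate of the bound witnesses: rational, `p`-INTEGRAL (not necessarily a unit)
    (uκ : ℚ) (huκ : (uκ : ℝ) = κ) (hκ0 : κ ≠ 0) (huκ1 : ‖(uκ : ℚ_[p])‖ ≤ 1)
    (d' : ℤ) (hcd : Int.gcd (c * d) A = 1) (hdd' : d * d' ≡ 1 [ZMOD (A : ℤ)])
    (hAN : Nat.Coprime A N)
    (aM : ℕ → ℤ) (haM : ∀ q ∈ (p * A).primeFactors, cuspCoeff f q = aM q)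
    -- the `p`-Euler factor TIMES Kato's constant is integral: `uκ·a_p/p`, `uκ·𝟙_{p∤N}/p ∈ ℤ_(p)`
    -- (additive `p`: `a_p = 0`, `p ∣ N`; good / multiplicative `p`: `p ∣ uκ`)
    (hκa : ‖((uκ * ((aM p : ℚ) / p) : ℚ) : ℚ_[p])‖ ≤ 1)
    (hκ1 : ‖((uκ * (if p ∣ N then 0 else (1 / p : ℚ)) : ℚ) : ℚ_[p])‖ ≤ 1)
    (hE0 : ∏ q ∈ (p * A).primeFactors, (1 - (aM q : ℚ) / q + (if q ∣ N then 0 else (1 / q : ℚ))) ≠ 0)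
    -- the COMBINED unit certificate: `v_p(uκ · ∏_{q ∣ pA} E_q(1)) = 0`
    (hκE : padicValRat p
      (uκ * ∏ q ∈ (p * A).primeFactors, (1 - (aM q : ℚ) / q + (if q ∣ N then 0 else (1 / q : ℚ)))) = 0)
    (hR0 : (c : ℚ) ^ 2 * (d : ℚ) ^ 2 * ratMinusSymbol f ((a : ℚ) / A) -
        (c : ℚ) * (d : ℚ) ^ 2 * ratMinusSymbol f ((a * c : ℚ) / A) -
        (c : ℚ) ^ 2 * (d : ℚ) * ratMinusSymbol f ((a * d' : ℚ) / A) +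
        (c : ℚ) * (d : ℚ) * ratMinusSymbol f ((a * c * d' : ℚ) / A) ≠ 0)
    (hR : padicValRat p ((c : ℚ) ^ 2 * (d : ℚ) ^ 2 * ratMinusSymbol f ((a : ℚ) / A) -
        (c : ℚ) * (d : ℚ) ^ 2 * ratMinusSymbol f ((a * c : ℚ) / A) -
        (c : ℚ) ^ 2 * (d : ℚ) * ratMinusSymbol f ((a * d' : ℚ) / A) +
        (c : ℚ) * (d : ℚ) * ratMinusSymbol f ((a * c * d' : ℚ) / A)) = 0)
    (η : (q : HeightOneSpectrum (𝓞 ℚ)) → (ZMod (Ideal.absNorm q.asIdeal))ˣ)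
    (j t : ℕ) (σ : HeightOneSpectrum (𝓞 ℚ) → absoluteGaloisGroup ℚ)
    (hσI : ∀ q, σ q ∈ (adicCompletionPrime ℚ q).inertia (absoluteGaloisGroup ℚ))
    (hσχ : ∀ q, modNCyclotomicCharacter ℚ (Ideal.absNorm q.asIdeal) (σ q) = η q)
    (r : Finset (HeightOneSpectrum (𝓞 ℚ)))
    (hr : ∀ q ∈ r, q ∈ (cyclotomicLevelsRat p (badPlaces c d A N)).primes)
    (hKol : ∀ q ∈ r, Kato.IsKolyvaginPrime W p (j + 1) ((primesEquiv q : Nat.Primes) : ℕ))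
    (hη : ∀ q ∈ r, Subgroup.zpowers (η q) = ⊤) :
    ∃ (s : ℤ_[p]) (u : (ZMod (p ^ (j + 1)))ˣ)
      (ψ : (ℓ : ℕ) → (ZMod ℓ)ˣ →* Multiplicative (ZMod (p ^ (j + 1)))),
      (∀ q ∈ r, Function.Surjective (ψ (Ideal.absNorm q.asIdeal))) ∧
      (∃ l ∈ cycIntLattice p (cycLevel p 0 r),
        ((p : ℤ_[p]) ^ t) • ((1 : ℚ_[p]) ⊗ₜ[ℚ]
          ((r.noncommProd (fun ℓ : HeightOneSpectrum (𝓞 ℚ) =>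
              ∑ j ∈ Finset.range (((primesEquiv ℓ : Nat.Primes) : ℕ) - 1),
                (j : Module.End ℚ (CyclotomicField (cycLevel p 0 r) ℚ)) *
                  (sigma (cycLevel p 0 r) (modNCyclotomicCharacter ℚ (cycLevel p 0 r) (σ ℓ)) :
                    CyclotomicField (cycLevel p 0 r) ℚ →ₐ[ℚ]
                      CyclotomicField (cycLevel p 0 r) ℚ).toLinearMap ^ j)
            (ZetaValue.pairwise_commute_fieldDeriv (cycLevel p 0 r)
              (fun ℓ => modNCyclotomicCharacter ℚ (cycLevel p 0 r) (σ ℓ))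
              (fun ℓ => ((primesEquiv ℓ : Nat.Primes) : ℕ) - 1) r))
            (x 0 ⟨r, hr⟩ + sigma (cycLevel p 0 r) (-1) (x 0 ⟨r, hr⟩)))) -
          ((s : ℚ_[p]) ⊗ₜ[ℚ] (1 : CyclotomicField (cycLevel p 0 r) ℚ)) =
        ((p : ℤ_[p]) ^ (j + 1)) • (l : ℚ_[p] ⊗[ℚ] CyclotomicField (cycLevel p 0 r) ℚ)) ∧
      haveI : NeZero (∏ q ∈ r, Ideal.absNorm q.asIdeal) :=
        ⟨Finset.prod_ne_zero_iff.2 fun q _ h => q.ne_bot (Ideal.absNorm_eq_zero_iff.1 h)⟩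
      PadicInt.toZModPow (j + 1) s = (u : ZMod (p ^ (j + 1))) *
        ((p : ℕ) : ZMod (p ^ (j + 1))) ^ t *
          kuriharaNumber f (p ^ (j + 1)) (∏ q ∈ r, Ideal.absNorm q.asIdeal) ψ := by
  classical
  -- the level `n = n(r)` and its primes
  have hprim : ∀ q ∈ r, ¬ ((primesEquiv q : Nat.Primes) : ℕ) ∣ 2 * c.natAbs * d.natAbs * A * N ∧
      ((primesEquiv q : Nat.Primes) : ℕ) ≠ p := fun q hq =>
    (mem_primes_cyclotomicLevelsRat_badPlaces_iff p c d A N q).mp (hr q hq)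
  have hn : cycLevel p 0 r = ∏ q ∈ r, ((primesEquiv q : Nat.Primes) : ℕ) :=
    TameLevel.cycLevel_zero_eq_prod p r
  have hsq : Squarefree (cycLevel p 0 r) := TameLevel.squarefree_cycLevel_zero p r
  have hnN : (cycLevel p 0 r).Coprime N := by
    rw [hn]
    exact Nat.Coprime.prod_left fun q hq => (Nat.Prime.coprime_iff_not_dvd (primesEquiv q).2).mpr
      fun h => (hprim q hq).1 (dvd_mul_of_dvd_right h _)
  have hncd : (cycLevel p 0 r).Coprime (c.natAbs * d.natAbs) := by
    rw [hn]
    exact Nat.Coprime.prod_left fun q hq => (Nat.Prime.coprime_iff_not_dvd (primesEquiv q).2).mpr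
      fun h => (hprim q hq).1 (by
        obtain ⟨w, hw⟩ := h
        exact ⟨2 * A * N * w, by rw [show 2 * c.natAbs * d.natAbs * A * N =
          (c.natAbs * d.natAbs) * (2 * A * N) by ring, hw]; ring⟩)
  have hM : (p * A).Coprime (cycLevel p 0 r) := by
    rw [hn]
    refine Nat.Coprime.prod_right fun q hq => Nat.Coprime.mul_left ?_ ?_
    · exact (Nat.coprime_primes Fact.out (primesEquiv q).2).mpr (hprim q hq).2.symm
    · exact ((Nat.Prime.coprime_iff_not_dvd (primesEquiv q).2).mpr fun h =>
        (hprim q hq).1 (dvd_mul_of_dvd_left (dvd_mul_of_dvd_right h _) _)).symm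
  have hcdn : Int.gcd (c * d) (cycLevel p 0 r * A) = 1 := by
    rw [Int.gcd_eq_natAbs] at hcd ⊢
    rw [Int.natAbs_mul] at hcd ⊢
    have h2 : ((cycLevel p 0 r : ℤ) * (A : ℤ)).natAbs = cycLevel p 0 r * A := by
      rw [Int.natAbs_mul, Int.natAbs_natCast, Int.natAbs_natCast]
    rw [Int.natAbs_natCast] at hcd
    rw [h2]
    exact Nat.Coprime.mul_right hncd.symm hcd
  -- R-κ (b′): `uκ ≠ 0`
  have huκ0 : uκ ≠ 0 := by rintro rfl; exact hκ0 (by rw [← huκ, Rat.cast_zero])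
  -- the embedding unit, the avatar, the units mod `n`
  obtain ⟨u, hι⟩ := CharSum.exists_units_apply_zeta_eq_exp (cycLevel p 0 r) (ι (cycLevel p 0 r))
  obtain ⟨X, hxX, -⟩ :=
    GroupRingEval.exists_unique_eq_sum_coeff_smul_sigma_zeta (cycLevel p 0 r) hsq (x 0 ⟨r, hr⟩)
  have hcu : IsUnit ((c : ℤ) : ZMod (cycLevel p 0 r)) := by
    rw [ZMod.coe_int_isUnit_iff_isCoprime, Int.isCoprime_iff_gcd_eq_one, Int.gcd_eq_natAbs,
      Int.natAbs_natCast]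
    exact Nat.Coprime.coprime_dvd_right (dvd_mul_right _ _) hncd
  have hdu : IsUnit ((d : ℤ) : ZMod (cycLevel p 0 r)) := by
    rw [ZMod.coe_int_isUnit_iff_isCoprime, Int.isCoprime_iff_gcd_eq_one, Int.gcd_eq_natAbs,
      Int.natAbs_natCast]
    exact Nat.Coprime.coprime_dvd_right (dvd_mul_left _ _) hncd
  let uq : ℕ → (ZMod (cycLevel p 0 r))ˣ := fun q =>
    if h : q.Coprime (cycLevel p 0 r) then ZMod.unitOfCoprime q h else 1
  have huq : ∀ q ∈ (p * A).primeFactors,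
      ((uq q : (ZMod (cycLevel p 0 r))ˣ) : ZMod (cycLevel p 0 r)) = q := by
    intro q hq
    have h : q.Coprime (cycLevel p 0 r) := Nat.Coprime.coprime_dvd_left (Nat.dvd_of_mem_primeFactors hq) hM
    simp only [uq, dif_pos h, ZMod.coe_unitOfCoprime]
  -- Kolyvagin depth
  have hK : ∀ q ∈ r, p ^ (j + 1) ∣ ((primesEquiv q : Nat.Primes) : ℕ) - 1 := fun q hq =>
    (Nat.modEq_iff_dvd' (primesEquiv q).2.one_lt.le).mp (hKol q hq).modEq_one.symm
  -- the integral structure `Θ₀` of `θ̃_f(n)` (Stevens integrality)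
  obtain ⟨Θ₀, hΘ⟩ := exists_padicLift_modularElement f p (cycLevel p 0 r) fun b => by
    have h := hf.norm_ratPlusSymbol_div_le_one hp2 hirr hnN ((b : ZMod (cycLevel p 0 r)).val : ℤ)
    rwa [Int.cast_natCast] at h
  -- the integral lift `V` of the twist
  have hQ := hf.coeffField_eq_bot
  have hreal : ∀ m, (cuspCoeff f m).im = 0 := cuspCoeff_im_eq_zero_of_coeffField_eq_bot hQ
  have hpM : p ∈ (p * A).primeFactors := Nat.mem_primeFactors.mpr ⟨Fact.out, dvd_mul_right p A,
    mul_ne_zero (Fact.out : p.Prime).ne_zero (NeZero.ne A)⟩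
  have haq : ∀ q ∈ (p * A).primeFactors.erase p, ‖((((aM q : ℚ) / q : ℚ)) : ℚ_[p])‖ ≤ 1 := fun q hq =>
    norm_ratCast_div_le_one_of_ne p (Nat.prime_of_mem_primeFactors (Finset.mem_of_mem_erase hq))
      (Finset.ne_of_mem_erase hq) (aM q)
  have hNq : ∀ q ∈ (p * A).primeFactors.erase p,
      ‖(((if q ∣ N then 0 else (1 / q : ℚ)) : ℚ) : ℚ_[p])‖ ≤ 1 := by
    intro q hq
    by_cases hqN : q ∣ N
    · rw [if_pos hqN, Rat.cast_zero, norm_zero]; exact zero_le_one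
    · rw [if_neg hqN]
      have h := norm_ratCast_div_le_one_of_ne p (Nat.prime_of_mem_primeFactors (Finset.mem_of_mem_erase hq))
        (Finset.ne_of_mem_erase hq) 1
      rwa [Int.cast_one] at h
  have hsymb : ∀ m : ℤ, ‖((ratMinusSymbol f ((m : ℚ) / A) : ℚ) : ℚ_[p])‖ ≤ 1 := fun m =>
    norm_ratMinusSymbol_le_one f hp2 hreal (coprime_den_of_coprime hAN m)
  obtain ⟨V, hV⟩ := exists_padicLift_twist_scaled p f u uκ (p * A) N uq aM _ rfl c d a d' A hcu.unit
    hdu.unit _ rfl _ rfl hpM huκ1 hκa hκ1 haq hNq (hsymb a)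
    (by have h := hsymb (a * c); rwa [Int.cast_mul] at h)
    (by have h := hsymb (a * d'); rwa [Int.cast_mul] at h)
    (by have h := hsymb (a * c * d'); rwa [Int.cast_mul, Int.cast_mul] at h)
  have hVu : IsUnit (∑ g : (ZMod (cycLevel p 0 r))ˣ, V.coeff g) :=
    isUnit_sum_coeff_twist_of_combined_certificate p hp2 f u uκ (p * A) N uq aM _ rfl c d a d' A hcu.unit
      hdu.unit _ rfl _ rfl V hV huκ0 hE0 hκE hR0 hR
  -- PK-4b-C4b-2 (v): the derivative congruence at `b := χ_n ∘ σ`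
  have hmem := EulerFactorComparison.prod_deriv_mul_plusAvatar_sub_mem_map_span_of_zetaBody
    hbody hf hp2 hirr ⟨r, hr⟩ d' hcdn hdd' uκ huκ u hι X hxX
    (fun q => modNCyclotomicCharacter ℚ (cycLevel p 0 r) (σ q))
    (fun q _ ℓ' hℓ' hne => unitsMap_modNCyclotomicCharacter_eq_one_of_mem_inertia p σ hσI r q hℓ' hne)
    uq huq aM haM _ rfl hcu.unit hdu.unit hcu.unit_spec hdu.unit_spec _ rfl _ rfl (j + 1) hK Θ₀ hΘ V hV
  -- T-PK6-VROW ★★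
  exact exists_valueRow_of_mem_map_span p f hp2 hf hirr j t σ η hσI hσχ r hη hKol (x 0 ⟨r, hr⟩) X hxX
    Θ₀ hΘ V hVu hmem

end Main

end Summit.BirchSwinnertonDyer.BirchSwinnertonDyer.Theorems.KimAtThreeDeepUpperValueRowsGeneral

end
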